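import Summits.ResolutionOfSingularities.ResolutionOfSingularities.Theorems.PurelyInseparableDim4ChartChainHistoryEscape
import HarnessLib

/-!
# Purely inseparable four-folds `z^p + F(x₁, …, x₄)`: CENTRE ESCAPE AT ANY DEPTH — turning into a fibre
# direction of the previous blow-up while sitting on the old strict transforms never globalises verbatim,
# whatever the older history (brick TY-2 g3 (a4) of cell `res-dim4-pi`)

[OURS · counted 0] (D-0157 DOOR 2; director-resolution DR-157-C; desk WORD #66 (4); frame
`PIDim4.TerminationImpliesOrderReduction`, S3 (c) coordinate regime; desk caveat FC-2 «centre escape»). Sequel of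
`PurelyInseparableDim4ChartChainHistoryEscape.lean` (the depth-three escape) and
`PurelyInseparableDim4ChartCentreIntegral.lean` (closedness = integrality at any depth). A chart of depth `n` of
the coordinate walk has history `Ψ_n = (Θ_n ψ_{j_n}) ∘ ⋯ ∘ (Θ₁ ψ_{j₁})` (oldest substitution innermost). Write the
last step as `(S, j, b, Θ)` and the older history as an ARBITRARY ring endomorphism `Ψ₀` of `K[z, x]`, so `Ψ_n = (Θ ψ_j) ∘ Ψ₀`; let `(S', j', b', Θ')` be the next step and `V(z, x_{S''})`, `j' ∉ S''`, the
candidate centre after it. PROVED here (no `sorry`, no new axiom):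

* **`not_isIntegral_history_step`** — if the new chart direction `x_{j'}` is a fibre direction of the PREVIOUS
  blow-up (`j' ∈ S.erase j`) and the point `b'` lies on the strict transform of the previous exceptional divisor
  and of the previous base hyperplanes whenever the candidate centre lies in them
  (`b'_m = 0` for `m ∈ ({j} ∪ (S' ∖ S)) ∩ S''`), then
  `K[z, x] —Ψ₀→ K[z, x] —Θψ_j→ K[z, x] —Θ'ψ_{j'}→ K[z, x] → K[z, x]/(z, x_{S''})` is NOT integral — for EVERY
  `Ψ₀`. Mechanism: every variable that the previous step made a fibre variable occurs in `Θψ_j(·)` only through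
  the product `x_j · (xᵢ + bᵢ)`; the `K(t)`-point `x_{j'} = t⁻¹`, `x_m = −b'_m` (`m ∈ {j} ∪ (S' ∖ S)`), all other
  coordinates `0`, kills `Θ'ψ_{j'}(x_j)` and makes EVERY `Θ'ψ_{j'}Θψ_j(x_k)`, `Θ'ψ_{j'}Θψ_j(z)` a constant, hence
  `χ ∘ Ψ_{n+1}` is evaluation of `Ψ₀` at a constant point of `𝔸⁵` — while `χ(x_{j'}) = t⁻¹ ∉ K[t]`.
* **`not_isClosed_image_CΛ_history_step`** — the scheme statement: for ANY separated universally closed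
  `ρ : Z ⟶ 𝔸⁵_K` (a blow-up tower), any open-immersion chart `φ : 𝔸⁵ ⟶ Z` of history `φ ≫ ρ = Spec ((Θψ_j) ∘ Ψ₀)`,
  ANY blowing up `π₂` of the global centre of `φ(V(z, x_{S'}))` and the re-centred chart of the chart `φ''`
  (`j' ∈ S'`, `b'`, `Θ'`): under the displayed condition `φ''(V(z, x_{S''}))` is NOT closed in `W₂`. This is the
  desk's FC-2 «centre escape» made DEPTH-UNIFORM: the two bits (is the new chart variable an old fibre variable;
  did the point leave the old exceptional divisor / base hyperplanes) decide escape at every depth; only the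
  CLOSED half depends on the older history `Ψ₀` from depth 4 on (`PurelyInseparableDim4ChartChainHistory.lean`
  settles depth 3, where `Ψ₀ = id`).

Nothing here is a statement about resolution of singularities in dimension ≥ 4 / characteristic `p` (NOT
proved anywhere in this programme). bears_on: LADDER-RESOLUTION:D157-DOOR2 (res-dim4-pi). Supports
stmt-ResolutionOfSingularities-16155 (helper, TY-2 g3 (a4)).
-/

-- every declaration of this summit lives under `Summit.ResolutionOfSingularities.ResolutionOfSingularities`
-- (summit = problem), which the duplicate-namespace linter flags; house convention (cf. the Target file).
set_option linter.dupNamespace false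

noncomputable section

open MvPolynomial Finset CategoryTheory AlgebraicGeometry Opposite TopologicalSpace
open AlgebraicGeometry.Scheme.IdealSheafData (ofIdealTop vanishingIdeal)

namespace Summit.ResolutionOfSingularities.ResolutionOfSingularities.Theorems.PIDim4

open Literature.AlgebraicGeometry.Resolution
open Literature.AlgebraicGeometry.Resolution.AffinePointBlowup (P A γ coord Wtop)

namespace ChartDictionary

/-! ## §1 Escape at any depth (algebra) -/

section AnyDepth

variable {K : Type} [Field K] {S S' S'' : Finset (Fin 4)} {j j' : Fin 4} {b b' : Fin 4 → K}
  {Θ Θ' : A 4 K →+* A 4 K}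

/-- **ESCAPE AT ANY DEPTH (algebra).** Let `Ψ₀` be any ring endomorphism of `K[z, x]` (the older
history — not even required to fix the constants), `(S, j, b, Θ)` the previous step and `(S', j', b', Θ')` the
next one, `V(z, x_{S''})` with `j' ∉ S''` the candidate centre. If `j' ∈ S.erase j` and `b'_m = 0` for every `m ∈ ({j} ∪ (S' ∖ S)) ∩ S''`, then
`K[z, x] → K[z, x]/(z, x_{S''})` precomposed with `(Θ'ψ_{j'}) ∘ ((Θψ_j) ∘ Ψ₀)` is NOT an integral ring map. -/
theorem not_isIntegral_history_step (Ψ₀ : A 4 K →+* A 4 K) (hj : j ∈ S) (hbj : b j = 0) (hC : ∀ c : K, Θ (C c) = C c) (hs : ∀ k : Fin 4, Θ (X k.succ) = X k.succ + C (b k))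
    (hbj' : b' j' = 0) (hC' : ∀ c : K, Θ' (C c) = C c) (hs' : ∀ k : Fin 4, Θ' (X k.succ) = X k.succ + C (b' k))
    (hj'S'' : j' ∉ S'') (h1 : j' ∈ S.erase j)
    (h2 : ∀ m : Fin 4, (m = j ∨ (m ∈ S' ∧ m ∉ S)) → m ∈ S'' → b' m = 0) :
    ¬ ((Ideal.Quotient.mk (AffineCoordBlowup.IΛ 4 K (insert 0 (Fin.succ '' (S'' : Set (Fin 4)))))).comp
        ((Θ'.comp (coordBlowupSubst K (insert 0 (Fin.succ '' (S' : Set (Fin 4)))) j'.succ).toRingHom).comp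
          ((Θ.comp (coordBlowupSubst K (insert 0 (Fin.succ '' (S : Set (Fin 4)))) j.succ).toRingHom).comp Ψ₀))).IsIntegral := by
  classical
  obtain ⟨hj'j, hj'S⟩ := Finset.mem_erase.mp h1
  -- the valuation ring `R = K[t]`, its fraction field `L`, and the escaping `L`-point
  set ι : Polynomial K →+* FractionRing (Polynomial K) := algebraMap (Polynomial K) (FractionRing (Polynomial K))
    with hι
  -- the constants the point assigns to the variables other than `x_{j'}`
  set c₁ : Fin 4 → K := fun k => if k = j ∨ (k ∈ S' ∧ k ∉ S) then -(b' k) else 0 with hc₁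
  have hc₁S'' : ∀ m : Fin 4, m ∈ S'' → c₁ m = 0 := by
    intro m hm
    by_cases hcond : m = j ∨ (m ∈ S' ∧ m ∉ S)
    · simp only [hc₁, if_pos hcond, h2 m hcond hm, neg_zero]
    · simp only [hc₁, if_neg hcond]
  have hc₁j : c₁ j = -(b' j) := by simp only [hc₁, true_or, if_true]
  have hc₁base : ∀ k : Fin 4, k ∉ S → k ∈ S' → c₁ k = -(b' k) := by
    intro k hkS hkS'
    have hcond : k = j ∨ (k ∈ S' ∧ k ∉ S) := Or.inr ⟨hkS', hkS⟩
    simp only [hc₁, if_pos hcond]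
  set v : Fin (4 + 1) → FractionRing (Polynomial K) :=
    Function.update (Fin.cases 0 fun k => ι (Polynomial.C (c₁ k))) j'.succ (ι Polynomial.X)⁻¹ with hv
  set χ : A 4 K →+* FractionRing (Polynomial K) := MvPolynomial.eval₂Hom (ι.comp Polynomial.C) v with hχ
  -- values of `χ`
  have hχj' : χ (X j'.succ) = (ι Polynomial.X)⁻¹ := by
    rw [hχ, eval₂Hom_X', hv, Function.update_self]
  have hχk : ∀ k : Fin 4, k ≠ j' → χ (X k.succ) = ι (Polynomial.C (c₁ k)) := by
    intro k hk
    rw [hχ, eval₂Hom_X', hv, Function.update_of_ne (fun e => hk (Fin.succ_inj.mp e)), Fin.cases_succ]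
  have hχ0 : χ (X 0) = 0 := by
    rw [hχ, eval₂Hom_X', hv, Function.update_of_ne (Fin.succ_ne_zero j').symm, Fin.cases_zero]
  have hχC : ∀ c : K, χ (C c) = ι (Polynomial.C c) := by
    intro c
    rw [hχ, eval₂Hom_C, RingHom.comp_apply]
  -- `χ` kills `(z, x_{S''})`
  have hker : ∀ a ∈ AffineCoordBlowup.IΛ 4 K (insert 0 (Fin.succ '' (S'' : Set (Fin 4)))), χ a = 0 := by
    refine IΛ_le_ker_of_X χ fun m hm => ?_
    rcases hm with hm | ⟨k, hk, rfl⟩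
    · rw [hm, hχ0]
    · rw [hχk k (fun e => hj'S'' (e ▸ hk)), hc₁S'' k hk, Polynomial.C_0, map_zero]
  -- constants pass through
  have hC'ψ' : ∀ c : K, Θ' (coordBlowupSubst K (insert 0 (Fin.succ '' (S' : Set (Fin 4)))) j'.succ (C c)) = C c := by
    intro c
    rw [coordBlowupSubst_C, hC']
  -- KEY: the next substitution sends `x_j` to something `χ` kills
  have hkill : χ (Θ' (coordBlowupSubst K (insert 0 (Fin.succ '' (S' : Set (Fin 4)))) j'.succ (X j.succ))) = 0 := by
    by_cases hjS' : j ∈ S'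
    · rw [clean_subst_X_fibre hbj' hs' hjS' hj'j.symm, map_mul, map_add, hχj', hχk j hj'j.symm, hχC, hc₁j,
        ← map_add, ← Polynomial.C_add, neg_add_cancel, Polynomial.C_0, map_zero, mul_zero]
    · rw [clean_subst_X_base hs' hjS', map_add, hχk j hj'j.symm, hχC, hc₁j, ← map_add, ← Polynomial.C_add,
        neg_add_cancel, Polynomial.C_0, map_zero]
  -- a base variable `x_k`, `k ∉ S`, of the previous step becomes the constant `c₁ k + b'_k` under `χ ∘ Θ'ψ'`
  have hbase : ∀ k : Fin 4, k ∉ S →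
      χ (Θ' (coordBlowupSubst K (insert 0 (Fin.succ '' (S' : Set (Fin 4)))) j'.succ (X k.succ))) =
        ι (Polynomial.C (c₁ k + b' k)) := by
    intro k hkS
    have hkj' : k ≠ j' := fun e => hkS (e ▸ hj'S)
    by_cases hkS' : k ∈ S'
    · rw [clean_subst_X_fibre hbj' hs' hkS' hkj', map_mul, map_add, hχC, hχk k hkj', hc₁base k hkS hkS',
        ← map_add, ← Polynomial.C_add, neg_add_cancel, Polynomial.C_0, map_zero, mul_zero]
    · rw [clean_subst_X_base hs' hkS', map_add, hχC, hχk k hkj', ← map_add, ← Polynomial.C_add]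
  -- hence `χ ∘ Θ'ψ' ∘ Θψ_j` is evaluation at a CONSTANT point
  set g : A 4 K →+* Polynomial K :=
    (Polynomial.C : K →+* Polynomial K).comp
      (MvPolynomial.eval (Fin.cases (0 : K) (fun k => if k ∈ S then 0 else c₁ k + b' k + b k))) with hg
  have hgC : ∀ c : K, g (C c) = Polynomial.C c := by
    intro c
    rw [hg, RingHom.comp_apply, eval_C]
  have hg0 : g (X 0) = 0 := by
    rw [hg, RingHom.comp_apply, eval_X, Fin.cases_zero, Polynomial.C_0]
  have hgS : ∀ k : Fin 4, k ∈ S → g (X k.succ) = 0 := by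
    intro k hk
    rw [hg, RingHom.comp_apply, eval_X, Fin.cases_succ, if_pos hk, Polynomial.C_0]
  have hgb : ∀ k : Fin 4, k ∉ S → g (X k.succ) = Polynomial.C (c₁ k + b' k + b k) := by
    intro k hk
    rw [hg, RingHom.comp_apply, eval_X, Fin.cases_succ, if_neg hk]
  have hfac₁ : χ.comp
      ((Θ'.comp (coordBlowupSubst K (insert 0 (Fin.succ '' (S' : Set (Fin 4)))) j'.succ).toRingHom).comp
        (Θ.comp (coordBlowupSubst K (insert 0 (Fin.succ '' (S : Set (Fin 4)))) j.succ).toRingHom)) = ι.comp g := by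
    refine MvPolynomial.ringHom_ext (fun c => ?_) (fun m => ?_)
    · simp only [RingHom.comp_apply, AlgHom.toRingHom_eq_coe, AlgHom.coe_toRingHom]
      rw [coordBlowupSubst_C, hC, hC'ψ', hχC, hgC]
    · simp only [RingHom.comp_apply, AlgHom.toRingHom_eq_coe, AlgHom.coe_toRingHom]
      refine Fin.cases ?_ (fun k => ?_) m
      · rw [clean_subst_X_zero hbj hs, map_mul, map_mul, map_mul, hkill, zero_mul, hg0, map_zero]
      · by_cases hkS : k ∈ S
        · by_cases hkj : k = j
          · subst hkj
            rw [clean_subst_X_chart hbj hs, hkill, hgS k hkS, map_zero]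
          · rw [clean_subst_X_fibre hbj hs hkS hkj, map_mul, map_mul, map_mul, hkill, zero_mul, hgS k hkS,
              map_zero]
        · rw [clean_subst_X_base hs hkS, map_add, map_add, map_add, hbase k hkS, hC'ψ', hχC, ← map_add,
            ← Polynomial.C_add, hgb k hkS]
  have hfac : χ.comp
      ((Θ'.comp (coordBlowupSubst K (insert 0 (Fin.succ '' (S' : Set (Fin 4)))) j'.succ).toRingHom).comp
        ((Θ.comp (coordBlowupSubst K (insert 0 (Fin.succ '' (S : Set (Fin 4)))) j.succ).toRingHom).comp Ψ₀)) =
      ι.comp (g.comp Ψ₀) := by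
    rw [← RingHom.comp_assoc, ← RingHom.comp_assoc, RingHom.comp_assoc _ _ χ, hfac₁, RingHom.comp_assoc]
  -- the witness: `χ(x_{j'}) = t⁻¹ ∉ K[t]`
  refine not_isIntegral_quotient_comp_of_witness χ hker (g.comp Ψ₀) hfac (a := X j'.succ) ?_
  rw [hχj', hι]
  exact inv_not_mem_range_algebraMap Polynomial.X_ne_zero Polynomial.not_isUnit_X

end AnyDepth

/-! ## §2 The scheme statement: FC-2 «centre escape» at every depth -/

section SchemeLevel

variable {K : Type} [Field K] {S S' S'' : Finset (Fin 4)} {j j' : Fin 4} {b b' : Fin 4 → K}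
  {Θ Θ' : A 4 K →+* A 4 K} {Z W₂ : Scheme.{0}} (φ : P 4 K ⟶ Z) [IsOpenImmersion φ] {π₂ : W₂ ⟶ Z}

/-- **CENTRE ESCAPE AT ANY DEPTH.** Let `ρ : Z ⟶ 𝔸⁵_K` be separated and universally closed (any blow-up tower),
`φ : 𝔸⁵ ⟶ Z` an open-immersion chart whose history ends with the step `(S, j, b, Θ)`:
`φ ≫ ρ = Spec ((Θψ_j) ∘ Ψ₀)` for some ring endomorphism `Ψ₀`; let `π₂ : W₂ → Z` be any blowing up of the global
centre of `φ(V(z, x_{S'}))`, `φ''` the chart of the chart at `(j' ∈ S', b', Θ')`, and `V(z, x_{S''})`, `j' ∉ S''`,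
the candidate next centre. If `j' ∈ S.erase j` and `b'_m = 0` for `m ∈ ({j} ∪ (S' ∖ S)) ∩ S''`, then
`φ''(V(z, x_{S''}))` is NOT closed in `W₂`. -/
theorem not_isClosed_image_CΛ_history_step [IsLocallyNoetherian Z] [IsIso (CommRingCat.ofHom Θ')]
    {ρ : Z ⟶ P 4 K} [IsSeparated ρ] [UniversallyClosed ρ] (Ψ₀ : A 4 K →+* A 4 K)
    (hj : j ∈ S) (hbj : b j = 0) (hC : ∀ c : K, Θ (C c) = C c)
    (hs : ∀ k : Fin 4, Θ (X k.succ) = X k.succ + C (b k))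
    (hc : φ ≫ ρ = Spec.map (CommRingCat.ofHom
      ((Θ.comp (coordBlowupSubst K (insert 0 (Fin.succ '' (S : Set (Fin 4)))) j.succ).toRingHom).comp Ψ₀)))
    (hj' : j' ∈ S') (hbj' : b' j' = 0) (hC' : ∀ c : K, Θ' (C c) = C c)
    (hs' : ∀ k : Fin 4, Θ' (X k.succ) = X k.succ + C (b' k))
    (hπ₂ : IsBlowup π₂ (vanishingIdeal (closureImage φ
      ((AffineCoordBlowup.𝓘Λ 4 K (insert 0 (Fin.succ '' (S' : Set (Fin 4))))).support : Set (P 4 K)))))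
    (hj'S'' : j' ∉ S'') (h1 : j' ∈ S.erase j)
    (h2 : ∀ m : Fin 4, (m = j ∨ (m ∈ S' ∧ m ∉ S)) → m ∈ S'' → b' m = 0) :
    ¬ IsClosed ((Spec.map (CommRingCat.ofHom Θ') ≫
        AffineCoordBlowup.chartImm (isBlowup_restrict_globalCentre φ _ hπ₂) (succ_mem_centreVars hj') ≫
          (π₂ ⁻¹ᵁ φ.opensRange).ι) ''
      (AffineCoordBlowup.CΛ 4 K (insert 0 (Fin.succ '' (S'' : Set (Fin 4)))) : Set (P 4 K))) := by
  rw [isClosed_image_CΛ_chart_of_chart_iff φ hc hπ₂ (succ_mem_centreVars hj') Θ' _]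
  exact not_isIntegral_history_step Ψ₀ hj hbj hC hs hbj' hC' hs' hj'S'' h1 h2

end SchemeLevel

/-! ## §3 Escape inside the restricted blow-up (any ambient, any depth) -/

section LocalEscape

variable {K : Type} [Field K] {Z W₂ : Scheme.{0}} (φ : P 4 K ⟶ Z) [IsOpenImmersion φ] {π₂ : W₂ ⟶ Z}
  {S' S'' : Finset (Fin 4)} {i j' : Fin 4} {b' : Fin 4 → K} {Θ' : A 4 K ≃ₐ[K] A 4 K}

/-- **ESCAPE INSIDE THE RESTRICTED BLOW-UP (any ambient, any depth).** If the candidate next centre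
`V(z, x_{S''})` misses a fibre variable of the step just made (`i ∈ S'`, `i ≠ j'`, `i ∉ S''`), then its image
under the chart of the chart `φ'' = Spec Θ' ≫ chartImm_{j'} ≫ (π₂⁻¹ φ(𝔸⁵) ↪ W₂)` is not even closed in
`π₂⁻¹ φ(𝔸⁵)` (typ-2 g2's depth-one escape `not_isClosed_image_CΛ_chart` for the restricted blow-up), hence not
closed in `W₂` — whatever the history. With `isClosed_image_CΛ_chart_of_chart` (`S' ⊆ S''`, closed) and the
history criterion (`S'.erase j' ⊆ S'' ∌ j'`) this exhausts the candidate next centres at every depth. -/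
theorem not_isClosed_image_CΛ_chart_of_chart_of_not_mem
    (hπ₂ : IsBlowup π₂ (vanishingIdeal (closureImage φ
      ((AffineCoordBlowup.𝓘Λ 4 K (insert 0 (Fin.succ '' (S' : Set (Fin 4))))).support : Set (P 4 K)))))
    (hj' : j' ∈ S') (hbj' : b' j' = 0) (hs' : ∀ k : Fin 4, Θ' (X k.succ) = X k.succ + C (b' k))
    (hiS' : i ∈ S') (hij' : i ≠ j') (hiS'' : i ∉ S'') :
    ¬ IsClosed ((Spec.map (CommRingCat.ofHom (Θ' : A 4 K →+* A 4 K)) ≫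
        AffineCoordBlowup.chartImm (isBlowup_restrict_globalCentre φ _ hπ₂) (succ_mem_centreVars hj') ≫
          (π₂ ⁻¹ᵁ φ.opensRange).ι) ''
      (AffineCoordBlowup.CΛ 4 K (insert 0 (Fin.succ '' (S'' : Set (Fin 4)))) : Set (P 4 K))) := by
  intro hcl
  apply not_isClosed_image_CΛ_chart hj' hbj' hs' (isBlowup_restrict_globalCentre φ _ hπ₂) hiS' hij' hiS''
  -- the composite chart is `ι ∘ (Spec Θ' ≫ chartImm)`; pull the closed image back along the open immersion `ι`
  have hcomp : ((Spec.map (CommRingCat.ofHom (Θ' : A 4 K →+* A 4 K)) ≫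
        AffineCoordBlowup.chartImm (isBlowup_restrict_globalCentre φ _ hπ₂) (succ_mem_centreVars hj') ≫
          (π₂ ⁻¹ᵁ φ.opensRange).ι : P 4 K ⟶ W₂) : P 4 K → W₂) =
      (π₂ ⁻¹ᵁ φ.opensRange).ι ∘ (Spec.map (CommRingCat.ofHom (Θ' : A 4 K →+* A 4 K)) ≫
        AffineCoordBlowup.chartImm (isBlowup_restrict_globalCentre φ _ hπ₂) (succ_mem_centreVars hj')) :=
    funext fun y => by simp only [Function.comp_apply, Scheme.Hom.comp_apply]
  rw [hcomp, Set.image_comp] at hcl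
  have h := hcl.preimage (π₂ ⁻¹ᵁ φ.opensRange).ι.continuous
  rwa [Set.preimage_image_eq _ (π₂ ⁻¹ᵁ φ.opensRange).ι.isOpenEmbedding.injective] at h

end LocalEscape

end ChartDictionary

end Summit.ResolutionOfSingularities.ResolutionOfSingularities.Theorems.PIDim4

end
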